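import Summits.QuantumFields.YangMills.Theses.HyperbolicRegulator
import Summits.QuantumFields.YangMills.Cruxes.HyperbolicToTorusR.Lines.replica_rooting
import Literature.Probability.LatticeModels.GibbsSpecificationProofs

/-!
# Disproof of `HyperbolicToTorusR` (stmt-QuantumFields-18156) — standing adversary work file (cdisprove, cycle 1)

Crux item `stmt-QuantumFields-18156` = `Summit.QuantumFields.YangMills.Theses.HyperbolicRegulator.HyperbolicToTorusR`
(route `HyperbolicRegulator`, rank 4, the REPAIRED "hyperbolic family ⇒ symmetric torus": flat `k/2 <`, deep
`3(k/4) <`, constant `∃ C` BEFORE `∀ k`).  Prose lives only in docstrings; every `theorem` is checked (rc 0);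
the file has NO `sorry`.  Predecessor (legacy decl `HyperbolicToTorus`, closed vacuous):
`Cruxes/HyperbolicToTorus/Disproof.lean` — its F1 (chart slip) and F3 (`C` after `k`) are REPAIRED in this decl
and are not repeated; its F0/F2 persist and are re-checked here against the repaired text (§1–§2).

## FINDINGS (cycle 1) — VERDICT: NO KILL; the crux is irrefutable short of `¬ UniformLatticeGap`

* **F0-R decoupling (§1, `cruxR_iff` is `Iff.rfl` against the route decl).**  The conclusion `TorusGap G r` is
  VERBATIM the body of the target `UniformLatticeGap` at `(G, r, borel G)` and does not mention the family:
  `UniformLatticeGap → HyperbolicToTorusR` (`hyperbolicToTorusR_of_uniformLatticeGap`),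
  `¬ HyperbolicToTorusR → ¬ UniformLatticeGap`, and the disproof burden (`not_cruxR_iff`) is ONE compact simple
  `G`, a faithful `r`, a family admissible at all scales clustering `k`-uniformly at all large `β` (= proofs of
  `CurvatureAnchorR ∧ CurvatureUniformityR` for it) AND `¬ TorusGap G r` (the weak-coupling lattice mass gap
  negated).  No junk escape: `IsCompactSimpleLieGroup` = connected ∧ non-abelian ∧ simple ∧ faithful unitary
  rep exists; `YMSpecies` = bounded measurable gauge-invariant cylinder functions.
* **F2-R load-bearing analysis (§2).**  Consequently NO `_false_without_H` lemma exists for ANY hypothesis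
  (`cruxRWithout{Adm,Clust}_of_torusGapAll`).  NEW, post-repair: the deep-points clause A8
  (`∃ x y, Dp x ∧ Dp y ∧ j ≤ Γ.dist x y`) is the ONLY admissibility clause excluding the EMPTY complex
  (`admRNoDeep_empty`, `admR_nonempty`); with A8 dropped the empty family is admissible at every scale, its
  clustering predicate is vacuous (`famClust_empty`), and the crux COLLAPSES to the target:
  `cruxRWithoutDeep_iff_torusGapAll`.  With A8 present, deep ⇒ flat for `k ≥ 4`
  (`flat_threshold_le_deep_threshold`), so the clustering hypothesis is never vacuous on an admissible member.
* **L1 LINE `replica_rooting` (§3, registered skeleton `Lines/replica_rooting.lean`, 5 stubs H₂/PTU/EXT/RT/V):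
  stub (EXT) `ExtremalInvariantStates` SECRETLY CONTAINS translation-invariant uniqueness.**  If every
  translation-invariant DLR state at `β` is extremal then there is AT MOST ONE translation-invariant DLR state at
  `β` (`transInv_unique_of_ext`: the midpoint `½μ₁ + ½μ₂` is a translation-invariant DLR state, hence extremal,
  hence `μ₁ = μ₂`; abstract core `eq_of_midpoint_mem_extremePoints`).  Consequences: (i) the hypothesis U_tr(β)
  of (RT) follows from its hypothesis EXT(β) (`utr_of_ext`); (ii) stub (PTU) `PressureTangentUnique` and the
  landed tangent bridge are REDUNDANT in `HyperbolicToTorusR_of` — `hyperbolicToTorusR_of_four_stubs :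
  (H₂) → (EXT) → (RT) → (V) → HyperbolicToTorusR` (kernel-checked here); (iii) (EXT) at weak coupling is a
  qualitative NO-PHASE-COEXISTENCE statement for 4D Wilson theory (uniqueness of the homogeneous DLR state), open
  in print — it is the line's true open core together with (V), not a "rate-free side condition".
* **L2 notes for the lead (docstrings of §3):** chart orientations are not axiomatised coherently across flat
  points (A9 fixes each chart only up to the 8-element point group of `ℤ²`), so (H₂) must invoke the clustering
  table for `B ∘ g`, `g` in the `8 × 8` hyperoctahedral reads, and take a finite max of the constants; under
  EXT(β) every ROOTED chart-local limit equals the root-averaged one (extremality of a barycentre), so rooted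
  local limits are automatically translation invariant.
* **Not attempted as theorems (out of reach / not cheap):** non-vacuity of `IsRootedPairState` via `μ ⊗ μ`
  (needs kernel measurability of `ymSpecification` slices — a prover's helper); any `(G, r, β)` where (EXT) or
  U_tr provably FAILS (none known for compact simple `G`; strong coupling has uniqueness by Dobrushin).

MESSAGE FOR PROVERS / LEAD.  The crux cannot be refuted without refuting the summit's lattice gap (F0-R); its
honest content after repair is "k-uniform chart-read clustering inside flat charts of radius `k/4 → ∞` ⇒ the
symmetric-torus gap with `S`-uniform constants", and on the registered line this splits into a soft local-limit
step (H₂, RT — buildable) and two OPEN statements: (EXT) = uniqueness+purity of the homogeneous phase at weak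
coupling, and (V) = finite-size passage from clustering of limit points to `n ≤ S` torus clustering.  Drop (PTU).
-/

noncomputable section

namespace Summit.QuantumFields.YangMills.Cruxes.HyperbolicToTorusR.Disproof

open scoped BigOperators ENNReal
open MeasureTheory
open Literature.MathematicalPhysics.QuantumFieldTheory (LatticeRep YMSpecies IsCompactSimpleLieGroup
  latticeConnectedCorr haarProbability)
open Literature.Probability.LatticeModels (IsExtremalGibbs gibbsMeasures IsGibbsMeasure convex_gibbsMeasures_holds)
open Literature.MathematicalPhysics.QuantumLattice (LGConfig ZdEdge configShift IsZdTranslationInvariant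
  ymSpecification ymGibbsMeasures infiniteVolumeLimitPoints mem_ymGibbsMeasures_of_mem_infiniteVolumeLimitPoints_holds)
open Summit.QuantumFields.YangMills.Theses.HyperbolicRegulator (HyperbolicToTorusR UniformLatticeGap)
open Summit.QuantumFields.YangMills.Cruxes.HyperbolicToTorusR.ReplicaRooting (Fam Sp IsRootedPairState
  RootedPairLimit PressureTangentUnique ExtremalInvariantStates ReplicaDecoupling TorusFiniteSize)

/-! ## §0 The repaired crux restated through named predicates (definitionally) -/

/-- **Admissibility A1–A9 at scale `(k, j)`** — VERBATIM the first component of the route's `let Fam := …`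
(and of the skeleton's `Fam G r`), which is `G`-free: pure combinatorics of the square complex with cones,
flat/deep points and charts. -/
def AdmR (k j : ℕ) (V E Q : Finset ℕ) (σ τ : ℕ → ℕ) (bd : ℕ → Fin 4 → ℕ × Bool) (cV : ℕ → ℤ × ℤ → ℕ)
    (cE : ℕ → ℤ × ℤ → Fin 2 → ℕ × Bool) : Prop :=
  let st := fun e : ℕ × Bool => if e.2 then σ e.1 else τ e.1; let en := fun e : ℕ × Bool => if e.2 then τ e.1 else σ e.1; let Γ := SimpleGraph.fromRel fun a b : ℕ => ∃ e ∈ E, σ e = a ∧ τ e = b; let dg := fun x : ℕ => (E.filter fun e => σ e = x ∨ τ e = x).card; let K := V.filter fun x => dg x = 5; let F := fun x : ℕ => x ∈ V ∧ ∀ c ∈ K, k / 2 < Γ.dist x c; let Dp := fun x : ℕ => x ∈ V ∧ ∀ c ∈ K, 3 * (k / 4) < Γ.dist x c; let ib := fun a : ℤ × ℤ => |a.1| ≤ (k : ℤ) / 4 ∧ |a.2| ≤ (k : ℤ) / 4; let nx := fun (a : ℤ × ℤ) (μ : Fin 2) => if μ = 0 then (a.1 + 1, a.2) else (a.1, a.2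 + 1); (∀ e ∈ E, σ e ∈ V ∧ τ e ∈ V ∧ σ e ≠ τ e) ∧ (∀ q ∈ Q, (∀ i, (bd q i).1 ∈ E) ∧ (∀ i, en (bd q i) = st (bd q (i + 1))) ∧ (st ∘ bd q).Injective) ∧ (∀ e ∈ E, (Q.filter fun q => ∃ i, (bd q i).1 = e).card = 2) ∧ (∀ x ∈ V, (dg x = 4 ∨ dg x = 5) ∧ (Q.filter fun q => ∃ i, st (bd q i) = x).card = dg x) ∧ (∀ x ∈ V, ∃ c ∈ K, Γ.dist x c ≤ k) ∧ (∀ c ∈ K, ∀ c' ∈ K, c ≠ c' → k ≤ Γ.dist c c') ∧ (∀ f : ℕ → ℝ, ∑ x ∈ V, f x = 0 → ∑ x ∈ V, f x ^ 2 ≤ 10 ^ 6 * (k : ℝ) ^ 2 * ∑ e ∈ E, (f (σ e) - f (τ e)) ^ 2) ∧ (∃ x y, Dp x ∧ Dp y ∧ j ≤ Γ.dist x y) ∧ (∀ x, F x → cV x (0, 0) = x ∧ (∀ a, ib a → cV x a ∈ V) ∧ Set.InjOn (cV x) {a | ib a} ∧ (∀ a μ, ib a → ib (nx a μ) → (cE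 x a μ).1 ∈ E ∧ st (cE x a μ) = cV x a ∧ en (cE x a μ) = cV x (nx a μ)) ∧ (∀ a, ib a → ib (a.1 + 1, a.2 + 1) → ∃ q ∈ Q, Finset.univ.image (Prod.fst ∘ bd q) = {(cE x a 0).1, (cE x (nx a 0) 1).1, (cE x (nx a 1) 0).1, (cE x a 1).1}))

/-- The first component of the line's `Fam G r` IS `AdmR` (definitional). -/
theorem fam_fst_iff (G : Type) [Group G] [TopologicalSpace G] [IsTopologicalGroup G] [CompactSpace G]
    [MeasurableSpace G] [BorelSpace G] (r : LatticeRep G) (k j : ℕ) (V E Q : Finset ℕ) (σ τ : ℕ → ℕ)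
    (bd : ℕ → Fin 4 → ℕ × Bool) (cV : ℕ → ℤ × ℤ → ℕ) (cE : ℕ → ℤ × ℤ → Fin 2 → ℕ × Bool) :
    (Fam G r k j V E Q σ τ bd cV cE).1 ↔ AdmR k j V E Q σ τ bd cV cE := Iff.rfl

/-- **Admissible at all scales `k ≥ 8`** (the crux's first hypothesis), `G`-free. -/
def AdmAll (V E Q : ℕ → ℕ → Finset ℕ) (σ τ : ℕ → ℕ → ℕ → ℕ) (bd : ℕ → ℕ → ℕ → Fin 4 → ℕ × Bool)
    (cV : ℕ → ℕ → ℕ → ℤ × ℤ → ℕ) (cE : ℕ → ℕ → ℕ → ℤ × ℤ → Fin 2 → ℕ × Bool) : Prop :=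
  ∀ k j, 8 ≤ k → AdmR k j (V k j) (E k j) (Q k j) (σ k j) (τ k j) (bd k j) (cV k j) (cE k j)

section Vocabulary

variable (G : Type) [Group G] [TopologicalSpace G] [IsTopologicalGroup G] [CompactSpace G]
  [MeasurableSpace G] [BorelSpace G]

/-- **The repaired `k`-UNIFORM clustering hypothesis** (`∃ C ∃ K` BEFORE `∀ k`; VERBATIM the crux's second
hypothesis and the conclusion of `CurvatureUniformityR`). -/
def UClust (r : LatticeRep G) (V E Q : ℕ → ℕ → Finset ℕ) (σ τ : ℕ → ℕ → ℕ → ℕ)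
    (bd : ℕ → ℕ → ℕ → Fin 4 → ℕ × Bool) (cV : ℕ → ℕ → ℕ → ℤ × ℤ → ℕ)
    (cE : ℕ → ℕ → ℕ → ℤ × ℤ → Fin 2 → ℕ × Bool) : Prop :=
  ∃ β₁ : ℝ, ∀ β, β₁ ≤ β → ∃ m : ℝ, 0 < m ∧ ∀ A B : YMSpecies G, ∃ C : ℝ, ∃ K : ℕ, ∀ k, K ≤ k →
    Sp A (k / 8) → Sp B (k / 8) → ∃ j₀ : ℕ, ∀ j, j₀ ≤ j →
      (Fam G r k j (V k j) (E k j) (Q k j) (σ k j) (τ k j) (bd k j) (cV k j) (cE k j)).2 β m C A B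

/-- **The conclusion** — VERBATIM the body of the target `UniformLatticeGap` at `(G, r)`; it does NOT mention
the family. -/
def TorusGap (r : LatticeRep G) : Prop :=
  ∃ β₀ : ℝ, ∀ β, β₀ ≤ β → ∃ m : ℝ, 0 < m ∧ ∃ S₁ : ℕ, ∀ A B : YMSpecies G, ∃ C : ℝ, ∀ S n, S₁ ≤ S → n ≤ S →
    |latticeConnectedCorr r.ρ β (2 * S + 1) A.F B.F n| ≤ C * Real.exp (-(m * n))

end Vocabulary

/-- **The crux, restated** through the named predicates. -/
def CruxR : Prop :=
  ∀ (G : Type) [Group G] [TopologicalSpace G] [IsTopologicalGroup G] [CompactSpace G], IsCompactSimpleLieGroup G →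
    letI : MeasurableSpace G := borel G; haveI : BorelSpace G := ⟨rfl⟩; ∀ r : LatticeRep G,
    ∀ (V E Q : ℕ → ℕ → Finset ℕ) (σ τ : ℕ → ℕ → ℕ → ℕ) (bd : ℕ → ℕ → ℕ → Fin 4 → ℕ × Bool)
      (cV : ℕ → ℕ → ℕ → ℤ × ℤ → ℕ) (cE : ℕ → ℕ → ℕ → ℤ × ℤ → Fin 2 → ℕ × Bool),
      AdmAll V E Q σ τ bd cV cE → UClust G r V E Q σ τ bd cV cE → TorusGap G r

set_option maxHeartbeats 800000 in
/-- `HyperbolicToTorusR` IS `CruxR`: the restatement only names sub-terms (checked by `Iff.rfl`). -/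
theorem cruxR_iff : HyperbolicToTorusR ↔ CruxR := Iff.rfl

/-! ## §1 (F0-R) Decoupling: the conclusion ignores the family — disproof burden -/

/-- The conclusion for ALL `(G, r)`: the target with the Borel σ-algebra fixed. -/
def TorusGapAll : Prop :=
  ∀ (G : Type) [Group G] [TopologicalSpace G] [IsTopologicalGroup G] [CompactSpace G], IsCompactSimpleLieGroup G →
    letI : MeasurableSpace G := borel G; haveI : BorelSpace G := ⟨rfl⟩; ∀ r : LatticeRep G, TorusGap G r

/-- `TorusGapAll` is the target `UniformLatticeGap` (the target's `[BorelSpace G]` forces `‹_› = borel G`). -/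
theorem torusGapAll_iff_uniformLatticeGap : TorusGapAll ↔ UniformLatticeGap := by
  constructor
  · intro h G _ _ _ _ m hB hG r
    obtain ⟨hm⟩ := hB
    subst hm
    exact h G hG r
  · intro h G _ _ _ _ hG r
    letI : MeasurableSpace G := borel G
    haveI : BorelSpace G := ⟨rfl⟩
    exact h G hG r

/-- The target implies the crux: BOTH hypotheses are idle for truth. -/
theorem cruxR_of_torusGapAll (h : TorusGapAll) : CruxR :=
  fun G _ _ _ _ hG r _ _ _ _ _ _ _ _ _ _ => h G hG r

/-- **`UniformLatticeGap → HyperbolicToTorusR`.** -/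
theorem hyperbolicToTorusR_of_uniformLatticeGap (h : UniformLatticeGap) : HyperbolicToTorusR :=
  cruxR_iff.2 (cruxR_of_torusGapAll (torusGapAll_iff_uniformLatticeGap.2 h))

/-- **A refutation of the crux refutes the target**: `¬ HyperbolicToTorusR → ¬ UniformLatticeGap`. -/
theorem not_uniformLatticeGap_of_not_hyperbolicToTorusR (h : ¬ HyperbolicToTorusR) : ¬ UniformLatticeGap :=
  fun hU => h (hyperbolicToTorusR_of_uniformLatticeGap hU)

/-- **Disproof burden.** `¬ CruxR` iff there are ONE compact simple `G`, a faithful `r` and a family admissible at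
all scales AND clustering `k`-uniformly at all large `β` (= proofs of `CurvatureAnchorR ∧ CurvatureUniformityR`
for it), while the torus gap FAILS for `(G, r)`.  Neither half is available. -/
theorem not_cruxR_iff : ¬ CruxR ↔ ∃ (G : Type) (_ : Group G) (_ : TopologicalSpace G) (_ : IsTopologicalGroup G)
    (_ : CompactSpace G), IsCompactSimpleLieGroup G ∧
    letI : MeasurableSpace G := borel G; haveI : BorelSpace G := ⟨rfl⟩;
    ∃ (r : LatticeRep G) (V E Q : ℕ → ℕ → Finset ℕ) (σ τ : ℕ → ℕ → ℕ → ℕ) (bd : ℕ → ℕ → ℕ → Fin 4 → ℕ × Bool)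
      (cV : ℕ → ℕ → ℕ → ℤ × ℤ → ℕ) (cE : ℕ → ℕ → ℕ → ℤ × ℤ → Fin 2 → ℕ × Bool),
      AdmAll V E Q σ τ bd cV cE ∧ UClust G r V E Q σ τ bd cV cE ∧ ¬ TorusGap G r := by
  constructor
  · intro h
    by_contra hne
    apply h
    intro G _ _ _ _ hG r V E Q σ τ bd cV cE hA hC
    by_contra hT
    exact hne ⟨G, ‹_›, ‹_›, ‹_›, ‹_›, hG, r, V, E, Q, σ, τ, bd, cV, cE, hA, hC, hT⟩
  · rintro ⟨G, _, _, _, _, hG, r, V, E, Q, σ, τ, bd, cV, cE, hA, hC, hT⟩ h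
    exact hT (h G hG r V E Q σ τ bd cV cE hA hC)

/-! ## §2 (F2-R) Load-bearing analysis; the deep-points clause A8 alone separates the crux from the target -/

/-- The crux with the CLUSTERING hypothesis dropped. -/
def CruxRWithoutClust : Prop :=
  ∀ (G : Type) [Group G] [TopologicalSpace G] [IsTopologicalGroup G] [CompactSpace G], IsCompactSimpleLieGroup G →
    letI : MeasurableSpace G := borel G; haveI : BorelSpace G := ⟨rfl⟩; ∀ r : LatticeRep G,
    ∀ (V E Q : ℕ → ℕ → Finset ℕ) (σ τ : ℕ → ℕ → ℕ → ℕ) (bd : ℕ → ℕ → ℕ → Fin 4 → ℕ × Bool)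
      (cV : ℕ → ℕ → ℕ → ℤ × ℤ → ℕ) (cE : ℕ → ℕ → ℕ → ℤ × ℤ → Fin 2 → ℕ × Bool),
      AdmAll V E Q σ τ bd cV cE → TorusGap G r

/-- The crux with the ADMISSIBILITY hypothesis dropped. -/
def CruxRWithoutAdm : Prop :=
  ∀ (G : Type) [Group G] [TopologicalSpace G] [IsTopologicalGroup G] [CompactSpace G], IsCompactSimpleLieGroup G →
    letI : MeasurableSpace G := borel G; haveI : BorelSpace G := ⟨rfl⟩; ∀ r : LatticeRep G,
    ∀ (V E Q : ℕ → ℕ → Finset ℕ) (σ τ : ℕ → ℕ → ℕ → ℕ) (bd : ℕ → ℕ → ℕ → Fin 4 → ℕ × Bool)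
      (cV : ℕ → ℕ → ℕ → ℤ × ℤ → ℕ) (cE : ℕ → ℕ → ℕ → ℤ × ℤ → Fin 2 → ℕ × Bool),
      UClust G r V E Q σ τ bd cV cE → TorusGap G r

/-- Dropping clustering: still implied by the target — no `_false_without_Clust`. -/
theorem cruxRWithoutClust_of_torusGapAll (h : TorusGapAll) : CruxRWithoutClust :=
  fun G _ _ _ _ hG r _ _ _ _ _ _ _ _ _ => h G hG r

/-- Dropping admissibility: still implied by the target — no `_false_without_Adm`. -/
theorem cruxRWithoutAdm_of_torusGapAll (h : TorusGapAll) : CruxRWithoutAdm :=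
  fun G _ _ _ _ hG r _ _ _ _ _ _ _ _ _ => h G hG r

/-- The weakenings imply the crux (trivially). -/
theorem cruxR_of_cruxRWithoutClust (h : CruxRWithoutClust) : CruxR :=
  fun G _ _ _ _ hG r V E Q σ τ bd cV cE hA _ => h G hG r V E Q σ τ bd cV cE hA

/-- The weakenings imply the crux (trivially). -/
theorem cruxR_of_cruxRWithoutAdm (h : CruxRWithoutAdm) : CruxR :=
  fun G _ _ _ _ hG r V E Q σ τ bd cV cE _ hC => h G hG r V E Q σ τ bd cV cE hC

/-- **A8 forces a vertex**: an admissible member has a (deep, hence) non-empty vertex set. -/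
theorem admR_nonempty {k j : ℕ} {V E Q : Finset ℕ} {σ τ : ℕ → ℕ} {bd : ℕ → Fin 4 → ℕ × Bool}
    {cV : ℕ → ℤ × ℤ → ℕ} {cE : ℕ → ℤ × ℤ → Fin 2 → ℕ × Bool} (h : AdmR k j V E Q σ τ bd cV cE) : V.Nonempty := by
  obtain ⟨-, -, -, -, -, -, -, ⟨x, -, hx, -, -⟩, -⟩ := h
  exact ⟨x, hx.1⟩

/-- For `k ≥ 4` the deep threshold dominates the flat one: `k/2 ≤ 3(k/4)`, so deep points are flat and the
clustering predicate `(Fam …).2` is never vacuous on an admissible member (A8 supplies deep points). For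
`k ∈ {2, 3}` the inequality FAILS (`3·0 < 1`), harmless under the crux's `8 ≤ k`. -/
theorem flat_threshold_le_deep_threshold {k : ℕ} (hk : 4 ≤ k) : k / 2 ≤ 3 * (k / 4) := by omega

/-- The chart sup-radius `k/4` dominates the support radius `k/8` the hypothesis allows: chart reads of the
admitted species stay inside the chart (no default-`1` reads) — the repaired decl has no slip here. -/
theorem support_radius_le_chart_radius (k : ℕ) : k / 8 + 1 ≤ k / 4 ∨ k < 8 := by omega

set_option linter.unusedVariables false in
/-- **Admissibility with the deep-points clause A8 DROPPED** (verbatim `AdmR` minus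
`(∃ x y, Dp x ∧ Dp y ∧ j ≤ Γ.dist x y) ∧`; `j` and `Dp` become idle, as the linter would note). -/
def AdmRNoDeep (k j : ℕ) (V E Q : Finset ℕ) (σ τ : ℕ → ℕ) (bd : ℕ → Fin 4 → ℕ × Bool) (cV : ℕ → ℤ × ℤ → ℕ)
    (cE : ℕ → ℤ × ℤ → Fin 2 → ℕ × Bool) : Prop :=
  let st := fun e : ℕ × Bool => if e.2 then σ e.1 else τ e.1; let en := fun e : ℕ × Bool => if e.2 then τ e.1 else σ e.1; let Γ := SimpleGraph.fromRel fun a b : ℕ => ∃ e ∈ E, σ e = a ∧ τ e = b; let dg := fun x : ℕ => (E.filter fun e => σ e = x ∨ τ e = x).card; let K := V.filter fun x => dg x = 5; let F := fun x : ℕ => x ∈ V ∧ ∀ c ∈ K, k / 2 < Γ.dist x c; let Dp := fun x : ℕ => x ∈ V ∧ ∀ c ∈ K, 3 * (k / 4) < Γ.dist x c; let ib := fun a : ℤ × ℤ => |a.1| ≤ (k : ℤ) / 4 ∧ |a.2| ≤ (k : ℤ) / 4; let nx := fun (a : ℤ × ℤ) (μ : Fin 2) => if μ = 0 then (a.1 +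 1, a.2) else (a.1, a.2 + 1); (∀ e ∈ E, σ e ∈ V ∧ τ e ∈ V ∧ σ e ≠ τ e) ∧ (∀ q ∈ Q, (∀ i, (bd q i).1 ∈ E) ∧ (∀ i, en (bd q i) = st (bd q (i + 1))) ∧ (st ∘ bd q).Injective) ∧ (∀ e ∈ E, (Q.filter fun q => ∃ i, (bd q i).1 = e).card = 2) ∧ (∀ x ∈ V, (dg x = 4 ∨ dg x = 5) ∧ (Q.filter fun q => ∃ i, st (bd q i) = x).card = dg x) ∧ (∀ x ∈ V, ∃ c ∈ K, Γ.dist x c ≤ k) ∧ (∀ c ∈ K, ∀ c' ∈ K, c ≠ c' → k ≤ Γ.dist c c') ∧ (∀ f : ℕ → ℝ, ∑ x ∈ V, f x = 0 → ∑ x ∈ V, f x ^ 2 ≤ 10 ^ 6 * (k : ℝ) ^ 2 * ∑ e ∈ E, (f (σ e) - f (τ e)) ^ 2) ∧ (∀ x, F x → cV x (0, 0) = x ∧ (∀ a, ib a → cV x a ∈ V) ∧ Set.InjOn (cV x) {a | ib a} ∧ (∀ a μ, ib a → ib (nx a μ) → (cE x a μ).1 ∈ E ∧ st (cE x a μ)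 = cV x a ∧ en (cE x a μ) = cV x (nx a μ)) ∧ (∀ a, ib a → ib (a.1 + 1, a.2 + 1) → ∃ q ∈ Q, Finset.univ.image (Prod.fst ∘ bd q) = {(cE x a 0).1, (cE x (nx a 0) 1).1, (cE x (nx a 1) 0).1, (cE x a 1).1}))

/-- A8 is the conjunct that was removed: `AdmR ↔ AdmRNoDeep ∧ A8`-direction used below. -/
theorem admRNoDeep_of_admR {k j : ℕ} {V E Q : Finset ℕ} {σ τ : ℕ → ℕ} {bd : ℕ → Fin 4 → ℕ × Bool}
    {cV : ℕ → ℤ × ℤ → ℕ} {cE : ℕ → ℤ × ℤ → Fin 2 → ℕ × Bool} (h : AdmR k j V E Q σ τ bd cV cE) :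
    AdmRNoDeep k j V E Q σ τ bd cV cE := by
  obtain ⟨h1, h2, h3, h4, h5, h6, h7, -, h9⟩ := h
  exact ⟨h1, h2, h3, h4, h5, h6, h7, h9⟩

/-- **The EMPTY complex is admissible-without-A8 at every scale**: every other clause quantifies over `V`, `E`,
`Q`, `K ⊆ V` or flat points `x ∈ V`, and the Poincaré clause A7 reads `0 ≤ 10⁶ k² · 0`. -/
theorem admRNoDeep_empty (k j : ℕ) (σ τ : ℕ → ℕ) (bd : ℕ → Fin 4 → ℕ × Bool) (cV : ℕ → ℤ × ℤ → ℕ)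
    (cE : ℕ → ℤ × ℤ → Fin 2 → ℕ × Bool) : AdmRNoDeep k j ∅ ∅ ∅ σ τ bd cV cE := by
  refine ⟨by simp, by simp, by simp, by simp, by simp, by simp, ?_, ?_⟩
  · intro f _
    simp
  · rintro x ⟨hx, -⟩
    simp at hx

/-- **The clustering predicate of the EMPTY complex is vacuous** (it quantifies over flat points `x ∈ V = ∅`),
for every `(β, m, C, A, B)`. -/
theorem famClust_empty (G : Type) [Group G] [TopologicalSpace G] [IsTopologicalGroup G] [CompactSpace G]
    [MeasurableSpace G] [BorelSpace G] (r : LatticeRep G) (k j : ℕ) (σ τ : ℕ → ℕ) (bd : ℕ → Fin 4 → ℕ × Bool)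
    (cV : ℕ → ℤ × ℤ → ℕ) (cE : ℕ → ℤ × ℤ → Fin 2 → ℕ × Bool) (β m C : ℝ) (A B : YMSpecies G) :
    (Fam G r k j ∅ ∅ ∅ σ τ bd cV cE).2 β m C A B := by
  intro x x' y y' hx
  exact absurd hx.1 (Finset.notMem_empty x)

/-- The crux with A8 dropped from admissibility (everything else verbatim). -/
def CruxRWithoutDeep : Prop :=
  ∀ (G : Type) [Group G] [TopologicalSpace G] [IsTopologicalGroup G] [CompactSpace G], IsCompactSimpleLieGroup G →
    letI : MeasurableSpace G := borel G; haveI : BorelSpace G := ⟨rfl⟩; ∀ r : LatticeRep G,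
    ∀ (V E Q : ℕ → ℕ → Finset ℕ) (σ τ : ℕ → ℕ → ℕ → ℕ) (bd : ℕ → ℕ → ℕ → Fin 4 → ℕ × Bool)
      (cV : ℕ → ℕ → ℕ → ℤ × ℤ → ℕ) (cE : ℕ → ℕ → ℕ → ℤ × ℤ → Fin 2 → ℕ × Bool),
      (∀ k j, 8 ≤ k → AdmRNoDeep k j (V k j) (E k j) (Q k j) (σ k j) (τ k j) (bd k j) (cV k j) (cE k j)) →
        UClust G r V E Q σ τ bd cV cE → TorusGap G r

/-- **Collapse lemma: without A8 the crux IS the target.**  (`→`: instantiate at the empty family, admissible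
without A8 at every scale and clustering vacuously with `β₁ = 0, m = 1, C = 0, K = 0, j₀ = 0`; `←`: F0-R.)  So the
two deep points at distance `≥ j` are the crux's only purchase beyond `UniformLatticeGap` — exactly the handle
the intended local-limit proof (`j → ∞` first, then `k → ∞`) needs. -/
theorem cruxRWithoutDeep_iff_torusGapAll : CruxRWithoutDeep ↔ TorusGapAll := by
  constructor
  · intro h G _ _ _ _ hG r
    letI : MeasurableSpace G := borel G
    haveI : BorelSpace G := ⟨rfl⟩
    refine h G hG r (fun _ _ => ∅) (fun _ _ => ∅) (fun _ _ => ∅) (fun _ _ => id) (fun _ _ => id)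
      (fun _ _ _ _ => (0, true)) (fun _ _ _ _ => 0) (fun _ _ _ _ _ => (0, true)) ?_ ?_
    · intro k j _
      exact admRNoDeep_empty k j id id _ _ _
    · refine ⟨0, fun β _ => ⟨1, one_pos, fun A B => ⟨0, 0, fun k _ _ _ => ⟨0, fun j _ => ?_⟩⟩⟩⟩
      exact famClust_empty G r k j id id _ _ _ β 1 0 A B
  · intro h G _ _ _ _ hG r _ _ _ _ _ _ _ _ _ _
    exact h G hG r

/-- And the crux itself is the A8-free crux restricted to A8-families (trivial direction, for the record). -/
theorem cruxR_of_cruxRWithoutDeep (h : CruxRWithoutDeep) : CruxR :=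
  fun G _ _ _ _ hG r V E Q σ τ bd cV cE hA hC =>
    h G hG r V E Q σ τ bd cV cE (fun k j hk => admRNoDeep_of_admR (hA k j hk)) hC

/-! ## §3 (L1) Line `replica_rooting`: stub (EXT) contains translation-invariant uniqueness; (PTU) is redundant -/

/-- **Abstract core.**  In an `ℝ≥0∞`-module, if the midpoint `½x₁ + ½x₂` of two points of `A` is an extreme point
of `A`, then `x₁ = x₂`. -/
theorem eq_of_midpoint_mem_extremePoints {M : Type*} [AddCommMonoid M] [Module ℝ≥0∞ M] {A : Set M} {x₁ x₂ : M}
    (h₁ : x₁ ∈ A) (h₂ : x₂ ∈ A)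
    (h : (2⁻¹ : ℝ≥0∞) • x₁ + (2⁻¹ : ℝ≥0∞) • x₂ ∈ Set.extremePoints ℝ≥0∞ A) : x₁ = x₂ := by
  have hseg : (2⁻¹ : ℝ≥0∞) • x₁ + (2⁻¹ : ℝ≥0∞) • x₂ ∈ openSegment ℝ≥0∞ x₁ x₂ :=
    ⟨2⁻¹, 2⁻¹, by simp, by simp, ENNReal.inv_two_add_inv_two, rfl⟩
  have h12 := (mem_extremePoints.1 h).2 x₁ h₁ x₂ h₂ hseg
  exact h12.1.trans h12.2.symm

section Line

variable {d N : ℕ} {G : Type*} [Group G] [TopologicalSpace G] [IsTopologicalGroup G] [CompactSpace G]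
  [MeasurableSpace G] [BorelSpace G] (ρ : G →* Matrix (Fin N) (Fin N) ℂ) (β : ℝ)

/-- The midpoint of two translation-invariant DLR states is a translation-invariant DLR state. -/
theorem midpoint_mem_and_transInv {μ₁ μ₂ : Measure (LGConfig d G)}
    (h₁ : μ₁ ∈ ymGibbsMeasures (d := d) ρ β) (h₂ : μ₂ ∈ ymGibbsMeasures (d := d) ρ β)
    (t₁ : IsZdTranslationInvariant μ₁) (t₂ : IsZdTranslationInvariant μ₂) :
    (2⁻¹ : ℝ≥0∞) • μ₁ + (2⁻¹ : ℝ≥0∞) • μ₂ ∈ ymGibbsMeasures (d := d) ρ β ∧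
      IsZdTranslationInvariant ((2⁻¹ : ℝ≥0∞) • μ₁ + (2⁻¹ : ℝ≥0∞) • μ₂) := by
  refine ⟨convex_gibbsMeasures_holds (ymSpecification (d := d) ρ β) h₁ h₂ (by simp) (by simp)
    ENNReal.inv_two_add_inv_two, fun v => ?_⟩
  rw [Measure.map_add _ _ (configShift v).measurable, Measure.map_smul, Measure.map_smul, t₁ v, t₂ v]

/-- **EXT(β) ⇒ at most one translation-invariant DLR state at `β`.**  If every translation-invariant DLR state
of Wilson's specification at `β` is extremal, any two of them coincide: their midpoint is again a
translation-invariant DLR state, hence an extreme point of `𝒢(β)` lying in the open segment between them. -/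
theorem transInv_unique_of_ext
    (hE : ∀ μ : Measure (LGConfig d G), μ ∈ ymGibbsMeasures (d := d) ρ β → IsZdTranslationInvariant μ →
      IsExtremalGibbs (ymSpecification (d := d) ρ β) μ)
    {μ₁ μ₂ : Measure (LGConfig d G)} (h₁ : μ₁ ∈ ymGibbsMeasures (d := d) ρ β)
    (h₂ : μ₂ ∈ ymGibbsMeasures (d := d) ρ β) (t₁ : IsZdTranslationInvariant μ₁) (t₂ : IsZdTranslationInvariant μ₂) :
    μ₁ = μ₂ := by
  obtain ⟨hG, hT⟩ := midpoint_mem_and_transInv ρ β h₁ h₂ t₁ t₂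
  exact eq_of_midpoint_mem_extremePoints h₁ h₂ (hE _ hG hT)

/-- **Contrapositive (the only way (EXT) can fail visibly):** two DISTINCT translation-invariant DLR states at `β`
refute EXT(β). -/
theorem not_ext_of_two_transInv_states {μ₁ μ₂ : Measure (LGConfig d G)}
    (h₁ : μ₁ ∈ ymGibbsMeasures (d := d) ρ β) (h₂ : μ₂ ∈ ymGibbsMeasures (d := d) ρ β)
    (t₁ : IsZdTranslationInvariant μ₁) (t₂ : IsZdTranslationInvariant μ₂) (hne : μ₁ ≠ μ₂) :
    ¬ ∀ μ : Measure (LGConfig d G), μ ∈ ymGibbsMeasures (d := d) ρ β → IsZdTranslationInvariant μ →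
      IsExtremalGibbs (ymSpecification (d := d) ρ β) μ :=
  fun hE => hne (transInv_unique_of_ext ρ β hE h₁ h₂ t₁ t₂)

/-- **EXT(β) ⇒ U_tr(β)**: the first hypothesis of stub (RT) `ReplicaDecoupling` follows from its second. -/
theorem utr_of_ext
    (hE : ∀ μ : Measure (LGConfig d G), μ ∈ ymGibbsMeasures (d := d) ρ β → IsZdTranslationInvariant μ →
      IsExtremalGibbs (ymSpecification (d := d) ρ β) μ)
    {α : Type*} (f : LGConfig d G → α → ℝ) :
    ∀ μ ν : Measure (LGConfig d G), μ ∈ ymGibbsMeasures (d := d) ρ β → ν ∈ ymGibbsMeasures (d := d) ρ β →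
      IsZdTranslationInvariant μ → IsZdTranslationInvariant ν → ∀ X : α, ∫ U, f U X ∂μ = ∫ U, f U X ∂ν := by
  intro μ ν hμ hν hμT hνT X
  rw [transInv_unique_of_ext ρ β hE hμ hν hμT hνT]

end Line

/-- **(PTU) is redundant on the line: `(H₂) → (EXT) → (RT) → (V) → HyperbolicToTorusR`** — the skeleton's
`HyperbolicToTorusR_of` with the pressure-tangent stub and the tangent bridge replaced by `utr_of_ext`.  (A
POSITIVE composition: it stays in this work file / the skeleton, it is not a `Negative/` lemma.) -/
theorem hyperbolicToTorusR_of_four_stubs (hH : RootedPairLimit) (hE : ExtremalInvariantStates)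
    (hR : ReplicaDecoupling) (hV : TorusFiniteSize) : HyperbolicToTorusR := by
  intro G _ _ _ _ hG r Fam₀ Sp₀ V E Q σ τ bd cV cE Φ hAdm hClust
  letI : MeasurableSpace G := borel G
  haveI : BorelSpace G := ⟨rfl⟩
  obtain ⟨β₁, hβ₁⟩ := hClust
  haveI : T2Space G := (r.continuous.isClosedEmbedding r.injective).isEmbedding.t2Space
  haveI : SecondCountableTopology G :=
    (r.continuous.isClosedEmbedding r.injective).isEmbedding.secondCountableTopology
  obtain ⟨βe, hβe⟩ := hE G hG r
  refine hV G hG r (max β₁ βe) ?_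
  intro β hβ
  have hβ1 : β₁ ≤ β := (le_max_left _ _).trans hβ
  have hβe' : βe ≤ β := (le_max_right _ _).trans hβ
  obtain ⟨m, hm, hCl⟩ := hβ₁ β hβ1
  refine ⟨m, hm, fun A B => ?_⟩
  obtain ⟨Qm, hQ, C, hC⟩ := hH G hG r V E Q σ τ bd cV cE hAdm β m hm hCl A B
  refine ⟨C, fun ν hν n => ?_⟩
  have hνG : ν ∈ ymGibbsMeasures (d := 4) r.ρ β :=
    mem_ymGibbsMeasures_of_mem_infiniteVolumeLimitPoints_holds (d := 4) r.ρ r.continuous hν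
  have hνT : IsZdTranslationInvariant ν :=
    Summit.QuantumFields.YangMills.Theorems.FibreToTorus.stub_torusLimitTranslationInvariant 4 r.N G r.ρ
      r.continuous β ν hν
  have hEβ : ∀ μ : Measure (LGConfig 4 G), μ ∈ ymGibbsMeasures (d := 4) r.ρ β → IsZdTranslationInvariant μ →
      IsExtremalGibbs (ymSpecification (d := 4) r.ρ β) μ := fun μ hμ hμT => hβe β hβe' μ hμ hμT
  exact hR G hG r β m A B C (utr_of_ext r.ρ β hEβ fun U (X : YMSpecies G) => X.F U) hEβ ⟨Qm, hQ, hC⟩ ν hνG hνT n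

/-! ## §4 (L2) Notes for the lead (no theorem content)

* **Chart orientation (H₂).**  A9 pins each chart `cV x` only up to the point group of `ℤ²` (an injective
  square-preserving grid embedding based at `x` is a rigid motion of any other); charts at different flat points
  need not be restrictions of one another.  Reading `τₙB` "in the chart at `x`" versus "in the chart at
  `y = cV x (n,0)`" differ by `B ↦ B ∘ g`, `g ∈ (D₄ × D₄)`; `YMSpecies` is closed under these 64 reads, so (H₂)
  goes through with `C = max_g C(A, B∘g)`, `K = max_g K(A, B∘g)` — bookkeeping, not an obstruction.
* **Rooted limits under EXT.**  If the root-averaged chart-local limit `ν₀` is translation invariant (Følner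
  averaging over the sub-box of radius `k/8`) then, at any `β` where EXT(β) holds, `ν₀` is extremal and is the
  barycentre of the rooted limits `μ_a ∈ 𝒢(β)`, so `μ_a = ν₀` for (almost) every root: rooted local limits are
  automatically translation invariant and `Q = ν₀ ⊗ ν₀` — consistent with (RT).
* **Where the line is genuinely open.**  (EXT) at `β ≥ βe` = "the homogeneous phase of 4D Wilson theory is unique
  and pure at weak coupling" (no print proof for non-abelian compact simple `G`; strong coupling has full
  Dobrushin uniqueness); (V) = finite-size passage `𝒢`-clustering ⇒ `n ≤ S` torus clustering with `S`-uniform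
  constants (needs vacuum dominance on the torus).  Neither is refutable here for the F0-R reason: each is implied
  by, or independent evidence for, the conjectured weak-coupling picture.
-/

end Summit.QuantumFields.YangMills.Cruxes.HyperbolicToTorusR.Disproof

end
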